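/-
Copyright (c) 2026 the pub-hodgecm-mathlib formalisation cell (harness21).  Prover seat hodgecm-mathlib-B-p04 (g30), floor 0, programme P5
(Alb-CM), row «split half of h1» FILE (B) (desk F0P5-plan (g4), 2026-08-31).  KERNEL module: THEOREMS ONLY (no definition, no named fact,
no `sorry`, no instance, no notation).
-/
import Literature.NumberTheory.Automorphic.Liu2021.LemD1SplitPlaceOfFacts
import Literature.NumberTheory.Automorphic.Liu2021.SplitPlaceOscillatorModelUniform
import Literature.NumberTheory.Automorphic.Zelevinsky1980.UnitaryCharacterInductionIrreducible
import Literature.NumberTheory.Automorphic.Liu2021.Def411WeilCarriersLocalFactorsGluing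
import Literature.NumberTheory.Automorphic.UnitaryGroupDualPairLocalLineHomeomorph
import Literature.NumberTheory.GelbartRogawski1991.LocalLineModelTransport
import Literature.NumberTheory.GelbartRogawski1991.UnitaryDualPairWeilCoinvariantsAdmissible
import HarnessLib

/-!
# [Liu2021, Lem. D.1, first sentence + (1)] AS PRINTED at a SPLIT place, every rank `n ≥ 2`, PROVED on the `U(V)(F_v)`-datum `localLemD1DataAtV₂`

Topic `NumberTheory/Automorphic/Liu2021`; namespace `Literature.NumberTheory.Automorphic.Liu2021.Def411WeilCarriers`.  KERNEL: theorems only.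
Cell hodgecm-mathlib FLOOR 0, programme P5, row «split half of `h1`» (desk F0P5-plan (g4), 2026-08-31T17:44Z): the assembler's hypothesis
`h1 := ∀ v, LemD1_1AsPrinted (localLemD1DataAtV₂ … v)` ([Liu2021, Lem. D.1 (1)] AS PRINTED per place, on the rank-`≥ 2` θ-package datum of
★ `LemD1Item4AsPrintedIndexed`, consumed by ★ `Def411WeilCarriersLocalFactorsGluing`) is DISCHARGED IN-HOUSE at the places SPLIT in `E`,
so that the printed letter need only be carried at the non-split places.

[Liu2021, proof of Lem. D.1, first paragraph (p. 126, l. 5253)]: «We identify `U(V)` with `GL_n(F)` … `ω(μ, ε, χ)` is isomorphic to the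
unitary induction from `P_{n−1,1}` of `(ν∘det) ⊠ χν^{1−n}` [GR90, 2.6].  The lemma follows from such description.»  In the tree the two
printed inputs are PROVED interface facts — ★ IV-3(a) `splitPlace_chiCoinv_iso_parabolicIndGL_holds` (the split-place model) and ★ IV-3(b)
`Zelevinsky1980.parabolicIndGL_detChar_unitary_isIrreducible_holds` ([Zelevinsky1980, Thm. 4.2]) — and ★ `splitPlace_model_consequences_of_facts`
drew the three adjectives (irreducible-or-zero, admissible, non-zero) of the `χ_v`-coinvariants `Θ_v` of `ω_v` on the BIG group
`U(J_V ⊗ J_W)(F_v)` from them, but with `3 ≤ n` hard-wired by its section (used only as `2 ≤ n`).  This file: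

* `splitPlace_model_consequences₂` — the same three adjectives, UNCONDITIONAL (facts fed by name) and for every `n ≥ 2`;
* `lemD1_1AsPrinted_localLemD1DataAtV₂_of_not_isField` — **`LemD1_1AsPrinted (localLemD1DataAtV₂ … v)` at a split `v`**, every `n ≥ 2`,
  under the UNITARITY hypothesis `hL2 : (𝓢.omegaLoc v).IsL2Isometric (μ′ⁿ)` of the split model (as in ★ `lemD1_1AsPrinted_localLemD1Data_of`;
  discharged for CM θ-undoublings by ★ `GRConstruction.isL2Isometric_omegaLoc_congrW_undoubledSplittings_cmFinLocalFamily`): the adjectives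
  descend from `Θ_v` to `Θ_v ∘ localLineInl v` along `k ↦ k ⊗ 1` — SURJECTIVE (★ `localLineInl_surjective`), CONTINUOUS
  (★ `continuous_localLineInl`) and OPEN (★ `isOpenMap_localLineInl`, `UnitaryGroupDualPairLocalLineHomeomorph`) — and then to the datum's
  `ω(μ_v, ε_v, χ_v)` along ★ `quotEquivLocalType₂` over the topological group isomorphism `uEquiv`; in item (1) both sides are `False`
  (the space is non-zero; `E_v` is not a field).

HONEST SCOPE: the printed lemma is NOT asserted anywhere; at split places it is a theorem of the tree, at non-split places it remains the
consumer's hypothesis.  Count-neutral until the P5 registrar cuts the ED. 5 letter to «non-split `v`».  HC_CM is proved only modulo the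
printed citations — the 2 remaining named inputs (hLiu418, h413) — until rung 0 closes.

## References
* [Liu2021] Y. Liu, Camb. J. Math. 9 (2021) = arXiv:2102.11518, App. D Lemma D.1, first sentence + (1) (l. 5226–5229), proof l. 5253 (p. 126).
* [GelbartRogawski1990] S. Gelbart, J. Rogawski, §2.6 (the split-place model).
* [Zelevinsky1980] A. Zelevinsky, Ann. Sci. ÉNS 13 (1980), Thm. 4.2.
* [BernsteinZelevinsky1976] I. N. Bernstein, A. V. Zelevinsky, Russian Math. Surveys 31 (1976), Definition 2.1(b) (admissibility).
-/

set_option autoImplicit false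

noncomputable section

open scoped Matrix Kronecker TensorProduct Classical RestrictedProduct
open NumberField IsDedekindDomain Filter Set
open _root_.MeasureTheory
open Literature.NumberTheory Literature.NumberTheory.Automorphic Literature.NumberTheory.Automorphic.UnitaryGroup
open Literature.NumberTheory.Weil1964 Literature.RepresentationTheory
open Literature.RepresentationTheory.HeisenbergGroup
open Literature.RepresentationTheory.CentralCharacterQuotient (augmentation)

namespace Literature.NumberTheory.Automorphic.Liu2021.Def411WeilCarriers

open Literature.NumberTheory.GelbartRogawski1991 Literature.NumberTheory.GelbartRogawski1991.UnitaryDualPair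
open Literature.NumberTheory.GelbartRogawski1991.UnitaryDualPair.WeilCoinv

variable (F E : Type) [Field F] [NumberField F] [Field E] [NumberField E] [Algebra F E]
variable (c : E ≃ₐ[F] E) (N : ℕ) {n : ℕ} (e : Fin N × Fin 1 ≃ Fin n)
variable (JV : Matrix (Fin N) (Fin N) E) {TV : Matrix (Fin N) (Fin N) F}
variable [Algebra.IsQuadraticExtension F E] {δ : E} (hcδ : c δ = -δ) (hδ : δ ≠ 0) {d : F} (hd : δ * δ = algebraMap F E d)

/-! ## §1 Smooth-character glue (the two private helpers of ★ `LemD1SplitPlaceOfFacts`, re-derived) -/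

section Characters

variable {K : Type*} [Field K]

/-- `x ↦ (χ′ ν^k)(x) = χ′(x) ν(x)^k ∈ ℂ` is continuous for continuous `ν, χ′ : Kˣ → ℂˣ`. [cite: BernsteinZelevinsky1976, Definition 2.1(b)] -/
private theorem continuous_coe_mul_zpow' [TopologicalSpace K] (ν χ' : Kˣ →* ℂˣ) (hνc : Continuous fun x => ((ν x : ℂˣ) : ℂ))
    (hχ'c : Continuous fun x => ((χ' x : ℂˣ) : ℂ)) (k : ℤ) :
    Continuous fun x => (((χ' * ν ^ k) x : ℂˣ) : ℂ) := by
  have h : (fun x => (((χ' * ν ^ k) x : ℂˣ) : ℂ)) = fun x => ((χ' x : ℂˣ) : ℂ) * ((ν x : ℂˣ) : ℂ) ^ k := by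
    funext x
    rw [MonoidHom.mul_apply, MonoidHom.zpow_apply, Units.val_mul, Units.val_zpow_eq_zpow_val]
  rw [h]
  exact hχ'c.mul (hνc.zpow₀ k fun x => Or.inl (Units.ne_zero _))

/-- `χ′ ν^k` is unitary for unitary `ν, χ′`. [cite: BernsteinZelevinsky1976, Definition 2.1(b)] -/
private theorem norm_coe_mul_zpow' (ν χ' : Kˣ →* ℂˣ) (hνu : ∀ x, ‖((ν x : ℂˣ) : ℂ)‖ = 1)
    (hχ'u : ∀ x, ‖((χ' x : ℂˣ) : ℂ)‖ = 1) (k : ℤ) (x : Kˣ) : ‖(((χ' * ν ^ k) x : ℂˣ) : ℂ)‖ = 1 := by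
  rw [MonoidHom.mul_apply, MonoidHom.zpow_apply, Units.val_mul, Units.val_zpow_eq_zpow_val, norm_mul, norm_zpow,
    hχ'u, hνu, one_zpow, one_mul]

end Characters

/-! ## §2 The three adjectives of `Θ_v` at a split place, every rank `n ≥ 2`, UNCONDITIONAL -/

section Split

/-- **[Liu2021, proof of Lem. D.1, l. 5253] at a SPLIT place, every `n ≥ 2`, facts discharged**: for a family `𝓢` whose local Weil
representation `ω_v = 𝓢.omegaLoc v` is `L²(μ′ⁿ)`-isometric, the `χ_{1,v}`-coinvariant quotient `Θ_v` of `ω_v` along the local centre is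
irreducible-or-zero, admissible and NON-ZERO on `U(J_V ⊗ J_W)(F_v)`.  = ★ `splitPlace_model_consequences_of_facts` with `3 ≤ n` relaxed to `2 ≤ n`
(the only use was IV-3(a)'s `2 ≤ N`) and the two interface facts fed by name: ★ `splitPlace_chiCoinv_iso_parabolicIndGL_holds`,
★ `Zelevinsky1980.parabolicIndGL_detChar_unitary_isIrreducible_holds`.
[cite: Liu2021, App. D, proof of Lemma D.1 (first paragraph), p. 126] [cite: Zelevinsky1980, Thm. 4.2] [cite: GelbartRogawski1990, §2.6] -/
theorem splitPlace_model_consequences₂ (hV : TV.IsSymm) (hVd : IsUnit TV.det) (hJV : JV = TV.map (algebraMap F E)) (a : Fˣ)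
    (𝓢 : LocalSplitting.FinLocalSplittings F E c n hcδ hδ hd (gram F e TV (TW F a)) (isSymm_gram F e hV (isSymm_TW F a))
      (reindex_kronecker_eq_gram_map F E e hJV (JW_eq F E a)))
    (hn : 2 ≤ n) (χ₁ : UnitaryGroup.finAdelicOne F E c →* ℂˣ) (hχ₁n : ∀ u, ‖((χ₁ u : ℂˣ) : ℂ)‖ = 1) (hχ₁c : Continuous χ₁)
    (v : HeightOneSpectrum (𝓞 F)) [MeasurableSpace (v.adicCompletion F)] [BorelSpace (v.adicCompletion F)]
    (μ' : Measure (v.adicCompletion F)) [μ'.IsAddHaarMeasure] :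
    ¬ IsField (LocalRing E v) → (𝓢.omegaLoc v).IsL2Isometric (Measure.pi fun _ : Fin n => μ') →
      IsIrreducibleOrZero (TwistedCoinv.rep
        (ρW := show Representation ℂ (localPi E c 1 (JW F E a) v) (SchwartzBruhat (Fin n → v.adicCompletion F)) from
          (𝓢.omegaLoc v).comp (localCenter E c n (Matrix.reindex e e (JV ⊗ₖ JW F E a)) (JW F E a) (JW_apply_ne_zero F E a) v))
        (localCharOfCenter F E c (JW F E a) (JW_apply_ne_zero F E a) χ₁ v) (𝓢.omegaLoc v)
        (fun g z => (show Commute g (localCenter E c n (Matrix.reindex e e (JV ⊗ₖ JW F E a)) (JW F E a) (JW_apply_ne_zero F E a) v z) from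
        localCenter_comm E c n (Matrix.reindex e e (JV ⊗ₖ JW F E a)) (JW F E a) (JW_apply_ne_zero F E a) v z g).map (𝓢.omegaLoc v))) ∧
      (TwistedCoinv.rep
        (ρW := show Representation ℂ (localPi E c 1 (JW F E a) v) (SchwartzBruhat (Fin n → v.adicCompletion F)) from
          (𝓢.omegaLoc v).comp (localCenter E c n (Matrix.reindex e e (JV ⊗ₖ JW F E a)) (JW F E a) (JW_apply_ne_zero F E a) v))
        (localCharOfCenter F E c (JW F E a) (JW_apply_ne_zero F E a) χ₁ v) (𝓢.omegaLoc v)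
        (fun g z => (show Commute g (localCenter E c n (Matrix.reindex e e (JV ⊗ₖ JW F E a)) (JW F E a) (JW_apply_ne_zero F E a) v z) from
        localCenter_comm E c n (Matrix.reindex e e (JV ⊗ₖ JW F E a)) (JW F E a) (JW_apply_ne_zero F E a) v z g).map (𝓢.omegaLoc v))).IsAdmissible ∧
      Nontrivial (TwistedCoinv.Coinv
        (show Representation ℂ (localPi E c 1 (JW F E a) v) (SchwartzBruhat (Fin n → v.adicCompletion F)) from
          (𝓢.omegaLoc v).comp (localCenter E c n (Matrix.reindex e e (JV ⊗ₖ JW F E a)) (JW F E a) (JW_apply_ne_zero F E a) v)) (localCharOfCenter F E c (JW F E a) (JW_apply_ne_zero F E a) χ₁ v)) := by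
  intro hsplit hL2
  haveI := secondCountableTopology_adicCompletion F v
  haveI : (Measure.pi fun _ : Fin n => μ').IsAddHaarMeasure := Measure.pi.isAddHaarMeasure _
  -- `J = J_V ⊗ (a)` is hermitian with non-zero determinant; `c ≠ 1`
  have hJh : ((Matrix.reindex e e (JV ⊗ₖ JW F E a)).map c)ᵀ = Matrix.reindex e e (JV ⊗ₖ JW F E a) :=
    reindex_kronecker_JW_hermitian F E c N e JV hV hJV a
  have hJu : IsUnit (Matrix.reindex e e (JV ⊗ₖ JW F E a)) :=
    (Matrix.isUnit_iff_isUnit_det _).2 (isUnit_iff_ne_zero.2 (det_reindex_kronecker_JW_ne_zero F E N e JV hVd hJV a))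
  have hc1 : c ≠ 1 := UnitaryGroup.algEquiv_ne_one_of_apply_eq_neg F E c hcδ hδ
  -- (i) a place `w ∣ v` moved by `c`; (ii) `J` invertible at `w`
  obtain ⟨w, hw⟩ := SplitPlace.exists_placesOver_smul_ne_of_not_isField E v c hc1 hsplit
  have hJw : IsUnit (placeForm (Matrix.reindex e e (JV ⊗ₖ JW F E a)) w.1) := isUnit_placeForm _ hJu w.1
  -- the local character of the centre: unitary and continuous
  have hχu := norm_localCharOfCenter F E c (JW F E a) (JW_apply_ne_zero F E a) hχ₁n v
  have hχc := continuous_coe_localCharOfCenter F E c (JW F E a) (JW_apply_ne_zero F E a) hχ₁c v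
  -- IV-3(a), PROVED: the model, at the section `𝓢.s v` (`𝓢.omegaLoc v = toRep ∘ 𝓢.s v` by `rfl`)
  obtain ⟨ν, χ', hνu, hνc, hχ'u, hχ'c, hiso⟩ := splitPlace_chiCoinv_iso_parabolicIndGL_holds F E c hc1 n hn δ hcδ hδ d hd
    (gram F e TV (TW F a)) (isSymm_gram F e hV (isSymm_TW F a)) (isUnit_det_gram F e hVd (isUnit_det_TW F a))
    (Matrix.reindex e e (JV ⊗ₖ JW F E a)) (reindex_kronecker_eq_gram_map F E e hJV (JW_eq F E a)) hJh v w hw hJw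
    (Measure.pi fun _ : Fin n => μ') (𝓢.s v) (𝓢.proj_s v) (𝓢.smooth v) hL2 (JW F E a) (JW_apply_ne_zero F E a)
    (localCharOfCenter F E c (JW F E a) (JW_apply_ne_zero F E a) χ₁ v) hχu hχc
  -- IV-3(b), PROVED: the induced representation is irreducible; and it is admissible (Bernstein–Zelevinsky)
  have hPirr := Zelevinsky1980.parabolicIndGL_detChar_unitary_isIrreducible_holds (w.1.adicCompletion E) n ν (χ' * ν ^ (1 - (n : ℤ)))
    hνu hνc (norm_coe_mul_zpow' ν χ' hνu hχ'u _) (continuous_coe_mul_zpow' ν χ' hνc hχ'c _)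
  have hPadm := Representation.isAdmissible_parabolicIndGL_holds (w.1.adicCompletion E) (Zelevinsky1980.lastBlockLabel n) _
    (SplitPlace.isAdmissible_trivial_twist_maxParabolicLeviChar (K := w.1.adicCompletion E) n ν χ' hνc hχ'c (1 - (n : ℤ)))
  -- transport back along the model and `localPiSplitEquiv` (glue (iv))
  exact SplitPlace.adjectives_of_areIsomorphicRep_comp_symm _ _ _ hiso hPirr hPadm

end Split

/-! ## §3 Lemma D.1, first sentence + (1), AS PRINTED at a split place on the `U(V)(F_v)`-datum `localLemD1DataAtV₂` -/

section AtV

set_option maxHeartbeats 1600000 in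
-- (the `…AtV₂` telescope of ★ `Def411WeilCarriersLocalFactorsGluing`, one pass)
/-- **[Liu2021, Lem. D.1, first sentence + (1)] AS PRINTED at a place `v` SPLIT in `E`, every rank `n ≥ 2`, on the rank-`≥ 2` datum
`localLemD1DataAtV₂ … v`** (the hypothesis `hD1` of ★ `localFactor_isAdmissible_of_lemD1_1AsPrinted` ∕ `localFactor_isIrreducible_of_lemD1_1AsPrinted`,
binders token for token, plus the split hypothesis and the unitarity hypothesis `hL2` of the split model): the three adjectives of
`splitPlace_model_consequences₂` descend from `U(J_V ⊗ J_W)(F_v)` to `U(J_V)(F_v)` along `localLineInl v` (onto, continuous, OPEN) and then to the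
datum's `ω(μ_v, ε_v, χ_v)` along ★ `quotEquivLocalType₂` over `uEquiv`; item (1) holds with both sides `False` (`E_v` is not a field; the
space is non-zero). [cite: Liu2021, App. D Lemma D.1 (1) (l. 5226–5229), proof l. 5253 (p. 126)] [cite: BernsteinZelevinsky1976, Definition 2.1(b)] -/
theorem lemD1_1AsPrinted_localLemD1DataAtV₂_of_not_isField (hV : TV.IsSymm) (hVd : IsUnit TV.det)
    (hJV : JV = TV.map (algebraMap F E)) (a : Fˣ)
    (𝓢 : LocalSplitting.FinLocalSplittings F E c n hcδ hδ hd (gram F e TV (TW F a)) (isSymm_gram F e hV (isSymm_TW F a))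
      (reindex_kronecker_eq_gram_map F E e hJV (JW_eq F E a)))
    (hn : 2 ≤ n) (μ : ∀ v : HeightOneSpectrum (𝓞 F), (LocalRing E v)ˣ →* ℂˣ) (hμn : ∀ v x, ‖((μ v x : ℂˣ) : ℂ)‖ = 1)
    (hμc : ∀ v, Continuous fun x => ((μ v x : ℂˣ) : ℂ))
    (hμF : ∀ (v : HeightOneSpectrum (𝓞 F)) (t : (v.adicCompletion F)ˣ),
      μ v (Units.map (algebraMap (v.adicCompletion F) (LocalRing E v)).toMonoidHom t) = 1 ↔
        ∃ x : (LocalRing E v)ˣ, (x : LocalRing E v) * conjLocal E c v x = algebraMap (v.adicCompletion F) (LocalRing E v) t)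
    (χ : Chi F E c) (v : HeightOneSpectrum (𝓞 F)) (hv : ¬ IsField (LocalRing E v))
    [MeasurableSpace (v.adicCompletion F)] [BorelSpace (v.adicCompletion F)]
    (μ' : Measure (v.adicCompletion F)) [μ'.IsAddHaarMeasure]
    (hL2 : (𝓢.omegaLoc v).IsL2Isometric (Measure.pi fun _ : Fin n => μ')) :
    LemD1_1AsPrinted (localLemD1DataAtV₂ F E c N e JV hcδ hδ hd hV hVd hJV a 𝓢 hn μ hμn hμc hμF χ v) := by
  -- the three adjectives of `Θ_v` on the big group
  obtain ⟨hirr, hadm, hnt⟩ := splitPlace_model_consequences₂ F E c N e JV hcδ hδ hd hV hVd hJV a 𝓢 hn χ.1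
    (norm_chi_eq_one F E c (Algebra.IsQuadraticExtension.finrank_eq_two F E) (UnitaryGroup.algEquiv_ne_one_of_apply_eq_neg F E c hcδ hδ) χ)
    χ.2.1 v μ' hv hL2
  -- `Θ_v ∘ localLineInl v` on `U(J_V)(F_v)`: irreducible (onto) and admissible (continuous + open)
  haveI := hnt
  have hirrΘ := isIrreducible_of_nontrivial hirr
  have hirr₁ : (show Representation ℂ (UnitaryGroup.localPi E c N JV v) _ from
      (TwistedCoinv.rep (localCharOfCenter F E c (JW F E a) (JW_apply_ne_zero F E a) χ.1 v) (𝓢.omegaLoc v)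
        (commute_omegaLoc_localCenter F E c N e JV (JW F E a) hcδ hδ hd hV (isSymm_TW F a) hJV (JW_eq F E a)
          (JW_apply_ne_zero F E a) 𝓢 v)).comp (UnitaryGroup.localLineInl E c N e JV (JW F E a) v)).IsIrreducible :=
    (Representation.isIrreducible_iff_of_equivariant _ _ (UnitaryGroup.localLineInl E c N e JV (JW F E a) v)
      (UnitaryGroup.localLineInl_surjective E c N e JV (JW F E a) (JW_apply_ne_zero F E a) v) (LinearEquiv.refl ℂ _)
      (fun _ _ => rfl)).2 hirrΘ
  have hadm₁ : (show Representation ℂ (UnitaryGroup.localPi E c N JV v) _ from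
      (TwistedCoinv.rep (localCharOfCenter F E c (JW F E a) (JW_apply_ne_zero F E a) χ.1 v) (𝓢.omegaLoc v)
        (commute_omegaLoc_localCenter F E c N e JV (JW F E a) hcδ hδ hd hV (isSymm_TW F a) hJV (JW_eq F E a)
          (JW_apply_ne_zero F E a) 𝓢 v)).comp (UnitaryGroup.localLineInl E c N e JV (JW F E a) v)).IsAdmissible :=
    Representation.IsAdmissible.comp_of_continuous_of_isOpenMap hadm _ (LocalSplitting.continuous_localLineInl F E c N JV v e (JW F E a))
      (UnitaryGroup.isOpenMap_localLineInl E c N e JV (JW F E a) (JW_apply_ne_zero F E a) v)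
  -- transport to the datum along `quotEquivLocalType₂` over `uEquiv`
  haveI hq : Nontrivial (SchwartzBruhat (Fin n → v.adicCompletion F) ⧸
      augmentation (localLemD1DataAtV₂ F E c N e JV hcδ hδ hd hV hVd hJV a 𝓢 hn μ hμn hμc hμF χ v).omega
        (localLemD1DataAtV₂ F E c N e JV hcδ hδ hd hV hVd hJV a 𝓢 hn μ hμn hμc hμF χ v).S.scalar
        (localLemD1DataAtV₂ F E c N e JV hcδ hδ hd hV hVd hJV a 𝓢 hn μ hμn hμc hμF χ v).chi) :=
    (quotEquivLocalType₂ F E c N e JV hcδ hδ hd hV hVd hJV a 𝓢 hn μ hμn hμc hμF χ v).toLinearEquiv.toEquiv.nontrivial_congr.2 hnt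
  have h1 : (localLemD1DataAtV₂ F E c N e JV hcδ hδ hd hV hVd hJV a 𝓢 hn μ hμn hμc hμF χ v).datum.quot.IsIrreducible :=
    (Representation.isIrreducible_iff_of_equivariant _ _
      (LemD1OfPlace.uEquiv E v c N JV hcδ hδ (two_le_rank_of_two_le N e hn) (transpose_map_conj_JV F E c N JV hV hJV)
        (det_JV_ne_zero F E N JV hVd hJV)).toMulEquiv.toMonoidHom
      (LemD1OfPlace.uEquiv E v c N JV hcδ hδ (two_le_rank_of_two_le N e hn) (transpose_map_conj_JV F E c N JV hV hJV)
        (det_JV_ne_zero F E N JV hVd hJV)).surjective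
      (quotEquivLocalType₂ F E c N e JV hcδ hδ hd hV hVd hJV a 𝓢 hn μ hμn hμc hμF χ v).toLinearEquiv
      (equiv_toLinearEquiv_apply_of_monoidHom
        (LemD1OfPlace.uEquiv E v c N JV hcδ hδ (two_le_rank_of_two_le N e hn) (transpose_map_conj_JV F E c N JV hV hJV)
          (det_JV_ne_zero F E N JV hVd hJV)).toMulEquiv.toMonoidHom
        (quotEquivLocalType₂ F E c N e JV hcδ hδ hd hV hVd hJV a 𝓢 hn μ hμn hμc hμF χ v))).2 hirr₁
  have h2 : (localLemD1DataAtV₂ F E c N e JV hcδ hδ hd hV hVd hJV a 𝓢 hn μ hμn hμc hμF χ v).datum.quot.IsAdmissible := by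
    refine Representation.IsAdmissible.of_equivariant_mulEquiv _
      (LemD1OfPlace.uEquiv E v c N JV hcδ hδ (two_le_rank_of_two_le N e hn) (transpose_map_conj_JV F E c N JV hV hJV)
        (det_JV_ne_zero F E N JV hVd hJV)).symm
      (quotEquivLocalType₂ F E c N e JV hcδ hδ hd hV hVd hJV a 𝓢 hn μ hμn hμc hμF χ v).toLinearEquiv.symm (fun g y => ?_) hadm₁
    have h := equiv_toLinearEquiv_apply_of_continuousMulEquiv
      (LemD1OfPlace.uEquiv E v c N JV hcδ hδ (two_le_rank_of_two_le N e hn) (transpose_map_conj_JV F E c N JV hV hJV)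
        (det_JV_ne_zero F E N JV hVd hJV))
      (quotEquivLocalType₂ F E c N e JV hcδ hδ hd hV hVd hJV a 𝓢 hn μ hμn hμc hμF χ v)
      ((LemD1OfPlace.uEquiv E v c N JV hcδ hδ (two_le_rank_of_two_le N e hn) (transpose_map_conj_JV F E c N JV hV hJV)
        (det_JV_ne_zero F E N JV hVd hJV)).symm g)
      ((quotEquivLocalType₂ F E c N e JV hcδ hδ hd hV hVd hJV a 𝓢 hn μ hμn hμc hμF χ v).toLinearEquiv.symm y)
    simp only [ContinuousMulEquiv.apply_symm_apply, LinearEquiv.apply_symm_apply] at h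
    apply (quotEquivLocalType₂ F E c N e JV hcδ hδ hd hV hVd hJV a 𝓢 hn μ hμn hμc hμF χ v).toLinearEquiv.injective
    rw [LinearEquiv.apply_symm_apply]
    exact h.symm
  refine ⟨⟨isIrreducibleOrZero_of_isIrreducible h1, h2⟩, iff_of_false (not_subsingleton _) ?_⟩
  rintro ⟨hF, -, -⟩
  exact hv hF

end AtV

end Literature.NumberTheory.Automorphic.Liu2021.Def411WeilCarriers

end
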